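import Mathlib
import Literature.Geometry.Lorentzian.LorentzianMetric
import Literature.Geometry.Lorentzian.ImmersionChartMetric
import Literature.Geometry.Lorentzian.IsometricImmersionExp
import Literature.Geometry.Lorentzian.GeodesicExistence
import Literature.Geometry.Lorentzian.GeodesicProofs
import Literature.Geometry.Lorentzian.GeodesicMaximal
import Literature.Geometry.Lorentzian.GeodesicExtension
import Literature.Geometry.Lorentzian.LeviCivitaProofs
import Literature.Geometry.Lorentzian.ConnectionNaturality

/-!
# Route PhotonSphereChannels · crux `TameCensorship` (stmt-FinalStateConjecture-17431) · line `Sketch`, skeleton v6 ·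
# stub `stub_chartGeodesic_of_injective`: a spacetime geodesic read in an injectively immersed chart is a geodesic
# of the pulled-back metric

Helper file (`--supports stmt-FinalStateConjecture-17431`) of line `Sketch` (lead c2, 2026-08-17), a brick of the
PANCAKE LAW (alternative route to clause (a) of K3). The lever reads a visible future-incomplete null geodesic `γ`
of a Cauchy development in a TAME chart `Ψ : U → 𝒟` (`U` a coordinate ball of `E4`, `Ψ` smooth, injective, with
injective differentials). To run the chart geodesic ODE and the forced-speed estimate one needs: the chart curve
`x = Ψ⁻¹ ∘ γ` is a geodesic of the pulled-back metric `Ψ^* g = ImmersionChart.metric …` on `U`, and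
`dΨ (x' t) = γ' t`. This is O'Neill 1983, Ch. 3, pp. 90–91 (local isometries preserve geodesics) read backwards
through the injectivity of `Ψ`, pointwise in the parameter (no continuation argument): at `t₁ ∈ s` the
differential `dΨ_{x t₁}` is invertible, so `γ' t₁ = dΨ w`; the `Ψ^* g`-geodesic `β` with data `(x t₁, w)`
(local existence, O'Neill Lemma 3.22, translated to `t₁`) is mapped by `Ψ` to a `g`-geodesic with the data of
`γ` at `t₁` (`PseudoRiemannianMetric.isGeodesicOn_comp_of_comap`), hence `Ψ ∘ β = γ` on a small open interval
about `t₁` (uniqueness, O'Neill Lemma 3.22/3.23), hence `β = x` there (injectivity), and the geodesic condition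
is local (`IsGeodesicOn.congr_holds`); the velocity identity follows from `x = β` near `t₁`.

References: B. O'Neill, *Semi-Riemannian Geometry with Applications to Relativity* (1983), Ch. 3, pp. 90–91,
Lemma 3.22, Prop. 3.59.
-/

set_option linter.dupNamespace false

open Literature.Geometry.Lorentzian
open scoped Manifold ContDiff Topology
open Set Filter Bundle

noncomputable section

namespace Summit.FinalStateConjecture.FinalStateConjecture.Theorems.PhotonSphereChannels.TameCensorshipUnwind

/-- **Stub `stub_chartGeodesic_of_injective` of line `Sketch` (skeleton v6) for the crux
`PhotonSphereChannels.TameCensorship` (stmt-FinalStateConjecture-17431): a spacetime geodesic inside an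
injectively immersed chart is a geodesic of the pulled-back metric.** For a smooth injective equidimensional
immersion `Ψ : U → 𝓢` of an open `U ⊆ E4` with the transported metric `Ψ^* g = ImmersionChart.metric …`, a
geodesic `γ` of `g` on an OPEN parameter set `s`, and any `x : ℝ → U` with `Ψ (x t) = γ t` on `s`: `x` is a
geodesic of `Ψ^* g` on `s` and `dΨ (x' t) = γ' t` there. Pointwise in `t₁ ∈ s`: `dΨ_{x t₁}` is invertible
(`isInvertible_mfderiv_of_injective`), so `γ' t₁ = dΨ w`; the `Ψ^* g`-geodesic `β` with data `(x t₁, w)`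
(`exists_isGeodesicOn_nhds_zero_holds`, translated by `t₁`, the `C¹` instance from
`isLocallyContMDiff_leviCivita_holds`) maps to a `g`-geodesic `Ψ ∘ β` with the data of `γ` at `t₁`
(`PseudoRiemannianMetric.isGeodesicOn_comp_of_comap`), so `Ψ ∘ β = γ` on a small open interval
(`IsGeodesicOn.eqOn_of_velocity_eq_holds`), hence `β = x` there (injectivity of `Ψ`), and the geodesic
condition is local (`IsGeodesicOn.congr_holds`); the velocity identity is `x' t₁ = β' t₁ = w`
(`velocity_congr_of_eventuallyEq`). [cite: ONeillSemiRiemannian1983, Ch. 3, pp. 90–91] -/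
theorem stub_chartGeodesic_of_injective :
    ∀ (𝓢 : Spacetime.{0} 4) [𝓢.metric.HasLeviCivita] (U : TopologicalSpace.Opens E4) (Ψ : U → 𝓢.carrier)
    (hΨ : ContMDiff 𝓘(ℝ, E4) (𝓡 4) (∞ + 1) Ψ)
    (hΨ' : ∀ u, Function.Injective (mfderiv 𝓘(ℝ, E4) (𝓡 4) Ψ u))
    (hdim : Module.finrank ℝ E4 = Module.finrank ℝ (EuclideanSpace ℝ (Fin 4))),
    Function.Injective Ψ →
    ∀ [(ImmersionChart.metric 𝓢.metric.toPseudoRiemannianMetric hΨ hΨ' hdim).HasLeviCivita]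
    (γ : ℝ → 𝓢.carrier) (x : ℝ → U) (s : Set ℝ), IsOpen s →
    IsGeodesicOn 𝓢.metric.leviCivita γ s → (∀ t ∈ s, Ψ (x t) = γ t) →
    IsGeodesicOn (ImmersionChart.metric 𝓢.metric.toPseudoRiemannianMetric hΨ hΨ' hdim).leviCivita x s ∧
      ∀ t ∈ s, (mfderiv 𝓘(ℝ, E4) (𝓡 4) Ψ (x t) (velocity 𝓘(ℝ, E4) x t) : E4) =
        (velocity (𝓡 4) γ t : E4) := by
  intro 𝓢 _ U Ψ hΨ hΨ' hdim hinj hLC γ x s hs hγ hΨx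
  set gU := ImmersionChart.metric 𝓢.metric.toPseudoRiemannianMetric hΨ hΨ' hdim with hgU_def
  haveI hLC' : (𝓢.metric.toPseudoRiemannianMetric.comap PseudoRiemannianMetric.contMDiff_pullbackBilin_holds
      Ψ hΨ hΨ' hdim).HasLeviCivita := hLC
  -- the Levi-Civita connections of the `C^∞` metrics `g` and `Ψ^* g` are `C¹`
  haveI : CovariantDerivative.ContMDiffCovariantDerivative 𝓢.metric.leviCivita 1 :=
    ⟨𝓢.metric.isLocallyContMDiff_leviCivita_holds 1 (by exact_mod_cast le_top) univ isOpen_univ⟩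
  haveI : CovariantDerivative.ContMDiffCovariantDerivative gU.leviCivita 1 :=
    ⟨gU.isLocallyContMDiff_leviCivita_holds 1 (by exact_mod_cast le_top) univ isOpen_univ⟩
  -- the pointwise claim: around each `t₁ ∈ s`, `x` is a `Ψ^* g`-geodesic, and `dΨ (x' t₁) = γ' t₁`
  have key : ∀ t₁ ∈ s, ∃ I : Set ℝ, IsOpen I ∧ t₁ ∈ I ∧ IsGeodesicOn gU.leviCivita x I ∧
      mfderiv 𝓘(ℝ, E4) (𝓡 4) Ψ (x t₁) (velocity 𝓘(ℝ, E4) x t₁) = velocity (𝓡 4) γ t₁ := by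
    intro t₁ ht₁
    -- (1) the chart velocity `w = dΨ⁻¹ (γ' t₁)`
    have hinv := PseudoRiemannianMetric.isInvertible_mfderiv_of_injective hdim (hΨ' (x t₁))
    set w : E4 := (mfderiv 𝓘(ℝ, E4) (𝓡 4) Ψ (x t₁)).inverse (velocity (𝓡 4) γ t₁) with hw_def
    have hΨw : mfderiv 𝓘(ℝ, E4) (𝓡 4) Ψ (x t₁) w = velocity (𝓡 4) γ t₁ := hinv.self_apply_inverse _
    -- (2) the `Ψ^* g`-geodesic with data `(x t₁, w)`, translated to `t₁`
    obtain ⟨β₀, J₀, hJ₀, hβ₀, hβ₀x, hβ₀v⟩ :=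
      exists_isGeodesicOn_nhds_zero_holds (cov := gU.leviCivita) BoundarylessManifold.isInteriorPoint
        (w : TangentSpace 𝓘(ℝ, E4) (x t₁))
    obtain ⟨b, hb, hbJ⟩ := Metric.mem_nhds_iff.1 hJ₀
    rw [Real.ball_eq_Ioo, zero_sub, zero_add] at hbJ
    set β : ℝ → U := fun t ↦ β₀ (t - t₁) with hβ_def
    have hβ : IsGeodesicOn gU.leviCivita β (Ioo (t₁ - b) (t₁ + b)) := by
      refine ((hβ₀.mono hbJ).comp_sub_const t₁).mono fun t ht ↦ ?_
      simp only [mem_preimage, mem_Ioo] at ht ⊢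
      constructor <;> linarith [ht.1, ht.2]
    have hβt₁ : β t₁ = x t₁ := by
      show β₀ (t₁ - t₁) = x t₁
      rw [sub_self]
      exact hβ₀x
    have hβv : velocity 𝓘(ℝ, E4) β t₁ = w := by
      rw [hβ_def, velocity_comp_sub_const β₀ t₁ t₁, sub_self]
      exact hβ₀v
    -- (3) `Ψ ∘ β` is a `g`-geodesic with velocity `dΨ (β')`
    obtain ⟨hΨβ, hΨβv⟩ := PseudoRiemannianMetric.isGeodesicOn_comp_of_comap
      𝓢.metric.toPseudoRiemannianMetric PseudoRiemannianMetric.contMDiff_pullbackBilin_holds hΨ hΨ' hdim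
      isOpen_Ioo hβ
    -- a small open interval about `t₁` inside `s` and the domain of `β`
    obtain ⟨c, hc, hcs⟩ := Metric.mem_nhds_iff.1 (hs.mem_nhds ht₁)
    rw [Real.ball_eq_Ioo] at hcs
    set r := min b c with hr_def
    have hrb : r ≤ b := min_le_left _ _
    have hrc : r ≤ c := min_le_right _ _
    have hr : 0 < r := lt_min hb hc
    have hIs : Ioo (t₁ - r) (t₁ + r) ⊆ s := fun t ht ↦ hcs ⟨by linarith [ht.1], by linarith [ht.2]⟩
    have hIJ : Ioo (t₁ - r) (t₁ + r) ⊆ Ioo (t₁ - b) (t₁ + b) := fun t ht ↦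
      ⟨by linarith [ht.1], by linarith [ht.2]⟩
    have ht₁I : t₁ ∈ Ioo (t₁ - r) (t₁ + r) := ⟨by linarith, by linarith⟩
    -- uniqueness: `Ψ ∘ β = γ` there
    have heq : EqOn (Ψ ∘ β) γ (Ioo (t₁ - r) (t₁ + r)) := by
      refine IsGeodesicOn.eqOn_of_velocity_eq_holds isOpen_Ioo ordConnected_Ioo (hΨβ.mono hIJ)
        (hγ.mono hIs) ht₁I ?_ ?_
      · show Ψ (β t₁) = γ t₁
        rw [hβt₁]
        exact hΨx t₁ ht₁
      · rw [hΨβv t₁ ⟨by linarith, by linarith⟩, hβv, hβt₁]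
        exact hΨw
    -- (4) injectivity: `β = x` there
    have hβx : EqOn β x (Ioo (t₁ - r) (t₁ + r)) := fun t ht ↦
      hinj ((heq ht).trans (hΨx t (hIs ht)).symm)
    -- (5) locality of the geodesic condition
    have hxI : IsGeodesicOn gU.leviCivita x (Ioo (t₁ - r) (t₁ + r)) :=
      IsGeodesicOn.congr_holds (hβ.mono hIJ) isOpen_Ioo hβx
    -- (6) the velocity identity: `x' t₁ = β' t₁ = w`
    have hev : x =ᶠ[𝓝 t₁] β := (eventuallyEq_of_mem (isOpen_Ioo.mem_nhds ht₁I) hβx).symm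
    have hvx : velocity 𝓘(ℝ, E4) x t₁ = w := by
      rw [velocity_congr_of_eventuallyEq hev]
      exact hβv
    refine ⟨Ioo (t₁ - r) (t₁ + r), isOpen_Ioo, ht₁I, hxI, ?_⟩
    rw [hvx]
    exact hΨw
  refine ⟨⟨fun t ht ↦ ?_, fun t ht ↦ ?_⟩, fun t ht ↦ ?_⟩
  · obtain ⟨I, -, htI, hxI, -⟩ := key t ht
    exact hxI.1 t htI
  · obtain ⟨I, -, htI, hxI, -⟩ := key t ht
    exact hxI.2 t htI
  · obtain ⟨I, -, -, -, hv⟩ := key t ht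
    exact hv

end Summit.FinalStateConjecture.FinalStateConjecture.Theorems.PhotonSphereChannels.TameCensorshipUnwind

end
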